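import Summits.AnomalousDissipation.AnomalousDissipation.Theorems.SolenoidalFractalHomogenisationRealisedQuasiStaticCellLawUpperSomeLadderTrapezoid
import Summits.AnomalousDissipation.AnomalousDissipation.Theorems.SolenoidalFractalHomogenisationRealisedQuasiStaticCellLawSlavedSlotIn
import HarnessLib

/-!
# K2R `RealisedQuasiStaticCellLaw`, line `floquet-bloch`, stub `stub_upperSome`: the LOWER slaved-ladder functional on the
# Galerkin truncation — lower law of the weighted OUT-OF-PLANE block energy over one FULL slot (weak coupling)

Summits-side helper file (everything proved; no definitions, no named facts; `--supports stmt-AnomalousDissipation-20446`).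
T2-lane file «UpperSomeSlotLaw» of STUB-PLAN `stub_upperSome` (per-slot LOWER law of the principal coset), realised with the
mirrored Lyapunov functional of `…UpperSomeLadderTrapezoid` instead of the kit slot map: along the Galerkin truncation of
order `N` of the cell problem and over the full slot `[pP + start j, pP + start j + τ_j]`, the out-of-plane components
`u_J = ⟪ζ, α_N(·)(k₀ + J•K_j)⟫` of a coset satisfy
`exp(−E)‖u₀(a)‖² − βΣ_{J≠0}‖u_J(a)‖² ≤ ‖u₀(a+τ_j)‖² − βΣ_{J≠0}‖u_J(a+τ_j)‖²` (and `≤ ‖u₀(t)‖²` inside the slot), with the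
second-order Taylor exponent `E = 2Λ_jτ_j(d₀ + (1+ε)σ g₁²(1 − 4ρ/3)) + slack` — the gauged ladder of `…OutOfPlaneBlock` fed
to `slavedLadder_trapezoid_ge`, exactly as `outOfPlane_slot_contraction` feeds `slavedLadder_trapezoid`. The in-plane twin is
`…UpperSomeSlotLawIn`. Not anomalous dissipation: this is the energy LOWER bound half of the K2R cell-law bracket.
-/

set_option linter.dupNamespace false -- layout D-0017: `AnomalousDissipation.AnomalousDissipation` repeats by design

noncomputable section

namespace Summit.AnomalousDissipation.AnomalousDissipation.Theorems.SolenoidalFractalHomogenisation.RealisedQuasiStaticCellLaw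

open Set MeasureTheory Filter Topology Function Complex Matrix
open scoped InnerProductSpace ComplexConjugate Matrix
open Literature.Analysis Literature.Analysis.FunctionSpaces Literature.Analysis.FunctionSpaces.Torus
open Literature.Analysis.FluidPDE Literature.Analysis.FluidPDE.LatticeShear
open Literature.Analysis.ODE.ThreeTermLadder
open Summit.AnomalousDissipation.AnomalousDissipation.Theorems.SolenoidalFractalHomogenisation.PermissibleCarrier

variable {k₀ : ℕ}

/-- **Weighted out-of-plane block energy: LOWER law over a full slot (weak coupling).** Slot `j` of the `p`-th
period, window `[a, a + τ_j]`, `a = pP + start j`, inside `[0, T]`; coset `k_J = k₀ + J•K_j`, `ζ ⊥ k₀, K_j`, index segment `Wset ∋ 0, ±1` of the resolved modes, normalised diagonal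
`d_J = |k_J|²/|K_j|²` with a gap `d_J ≥ d₀ + Δ` off `0`, `Λ = κ4π²|K_j|²`, peak coupling `g₁ = 2π(ê_j·k₀)|a_j|/(nΛ)`,
second-order weight `σ = 1/(d₋₁−d₀) + 1/(d₁−d₀)`, weight `β ≥ 0` with `2 ≤ βΔεσ`, weak coupling `g₁²(8/Δ + 2σ) ≤ Δ`:
`exp(−E)‖u₀(a)‖² − βΣ_{J∈Wset∖0}‖u_J(a)‖² ≤ ‖u₀(a+τ_j)‖² − βΣ_{J∈Wset∖0}‖u_J(a+τ_j)‖²` and, for every `t` in the slot,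
`exp(−E)‖u₀(a)‖² − βΣ_{J∈Wset∖0}‖u_J(a)‖² ≤ ‖u₀(t)‖²`, `E = 2Λτ_j(d₀ + (1+ε)σg₁²(1−4ρ/3)) + 80βΛτ_jg₁⁴(1+g₁²σ²)/Δ³ + 96βg₁²/(ρτ_jΛΔ³)`,
`u_J(t) = ⟪ζ, α_N(t)(k_J)⟫`, uniformly in `N` (`slavedLadder_trapezoid_ge` on the gauged ladder of `…OutOfPlaneBlock`; the
weak-coupling hypothesis carries the ramp slack, mirror of `outOfPlane_slot_contraction`). -/
theorem outOfPlane_slot_lower (W : LatticeWord k₀) {n : ℕ} (hn : 0 < n) {κ : ℝ} (hκ : 0 < κ)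
    (ℓ : Fin 3 → ℤ) {w₀ : UnitAddTorus (Fin 3) → EuclideanSpace ℝ (Fin 3)}
    (hw₀ : FunctionSpaces.Torus.MemSobolev 1 (FunctionSpaces.EuclideanSpace.complexify ∘ w₀))
    (hdiv : FunctionSpaces.Torus.IsWeaklyDivFree w₀) (hmean : FunctionSpaces.Torus.HasZeroMean w₀)
    (hsupp : ∀ k : Fin 3 → ℤ, ¬ ((∃ z : Fin 3 → ℤ, k = ℓ + (n:ℤ) • z) ∨ (∃ z : Fin 3 → ℤ, k = -ℓ + (n:ℤ) • z)) →
      UnitAddTorus.mFourierCoeff (FunctionSpaces.EuclideanSpace.complexify ∘ w₀) k = 0)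
    {N : ℕ} (hBN : (Finset.univ.biUnion fun j : Fin k₀ =>
        ({(fun i => (W.phase j).m i * n), -(fun i => (W.phase j).m i * n)} : Finset (Fin 3 → ℤ))) ⊆ freqBall N)
    {T : ℝ} (p : ℕ) (j : Fin k₀) (hT : (p : ℝ) * W.period + W.start j + (W.phase j).τ ≤ T)
    (k0 : Fin 3 → ℤ) {ζ : EuclideanSpace ℂ (Fin 3)} (hζ₀ : ∑ i, (k0 i : ℂ) * ζ i = 0)
    (hζK : ∑ i, (((fun i => (W.phase j).m i * (n : ℤ)) i : ℤ) : ℂ) * ζ i = 0)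
    {Wset : Finset ℤ} (hW : ∀ J : ℤ, J ∈ Wset ↔ k0 + J • (fun i => (W.phase j).m i * (n : ℤ)) ∈ freqBall N)
    (h0 : (0 : ℤ) ∈ Wset) (h1 : (1 : ℤ) ∈ Wset) (hm1 : (-1 : ℤ) ∈ Wset)
    (Λ Δ ε β σ g₁ : ℝ) (hΛ : Λ = κ * (4 * Real.pi ^ 2 * freqNormSq (fun i => (W.phase j).m i * (n : ℤ))))
    (hΔ0 : 0 < Δ) (hε : 0 ≤ ε) (hβ : 0 ≤ β)
    (hgap : ∀ J ∈ Wset, J ≠ 0 →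
      freqNormSq k0 / freqNormSq (fun i => (W.phase j).m i * (n : ℤ)) + Δ ≤
        freqNormSq (k0 + J • (fun i => (W.phase j).m i * (n : ℤ))) / freqNormSq (fun i => (W.phase j).m i * (n : ℤ)))
    (hσ : σ = 1 / (freqNormSq (k0 + (-1 : ℤ) • (fun i => (W.phase j).m i * (n : ℤ))) /
          freqNormSq (fun i => (W.phase j).m i * (n : ℤ)) - freqNormSq k0 / freqNormSq (fun i => (W.phase j).m i * (n : ℤ))) +
        1 / (freqNormSq (k0 + (1 : ℤ) • (fun i => (W.phase j).m i * (n : ℤ))) /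
          freqNormSq (fun i => (W.phase j).m i * (n : ℤ)) - freqNormSq k0 / freqNormSq (fun i => (W.phase j).m i * (n : ℤ))))
    (hg₁ : g₁ = 2 * Real.pi * (∑ i, (W.phase j).e i * (k0 i : ℝ)) *
        ‖Complex.exp ((W.phase j).φ * Complex.I) *
          (1 / (2 * ((2 * Real.pi * ‖latticeVec (W.phase j).m‖ : ℝ) : ℂ) * Complex.I))‖ * (1 / (n : ℝ)) / Λ)
    (hβγ : 2 ≤ β * Δ * ε * σ)
    (hsmall : g₁ ^ 2 * (4 * 2 / Δ + 2 * (1 + ε) * σ) +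
      2 * (4 * β * 2 * (Λ * |g₁| ^ 3 * σ + |g₁| / (W.ramp * (W.phase j).τ) + Λ * |g₁| ^ 2) ^ 2 / (Λ * Δ ^ 3)) / Λ ≤ Δ) :
    (Real.exp (-(2 * Λ * (W.phase j).τ * (freqNormSq k0 / freqNormSq (fun i => (W.phase j).m i * (n : ℤ)) +
            (1 + ε) * σ * (g₁ ^ 2 * (1 - 4 * W.ramp / 3))) +
          40 * β * 2 * Λ * (W.phase j).τ * g₁ ^ 4 * (1 + g₁ ^ 2 * σ ^ 2) / Δ ^ 3 +
          48 * β * 2 * g₁ ^ 2 / (W.ramp * (W.phase j).τ * Λ * Δ ^ 3))) *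
        ‖inner ℂ ζ ((pvSetup_cell W hn hκ.le ℓ hw₀ hdiv hmean hsupp).galerkinCoeffAt N
            ((p : ℝ) * W.period + W.start j) k0)‖ ^ 2 -
        β * ∑ J ∈ Wset.erase 0, ‖inner ℂ ζ ((pvSetup_cell W hn hκ.le ℓ hw₀ hdiv hmean hsupp).galerkinCoeffAt N
            ((p : ℝ) * W.period + W.start j) (k0 + J • (fun i => (W.phase j).m i * (n : ℤ))))‖ ^ 2 ≤
      ‖inner ℂ ζ ((pvSetup_cell W hn hκ.le ℓ hw₀ hdiv hmean hsupp).galerkinCoeffAt N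
          ((p : ℝ) * W.period + W.start j + (W.phase j).τ) k0)‖ ^ 2 -
        β * ∑ J ∈ Wset.erase 0, ‖inner ℂ ζ ((pvSetup_cell W hn hκ.le ℓ hw₀ hdiv hmean hsupp).galerkinCoeffAt N
          ((p : ℝ) * W.period + W.start j + (W.phase j).τ) (k0 + J • (fun i => (W.phase j).m i * (n : ℤ))))‖ ^ 2) ∧
    ∀ t ∈ Icc ((p : ℝ) * W.period + W.start j) ((p : ℝ) * W.period + W.start j + (W.phase j).τ),
      Real.exp (-(2 * Λ * (W.phase j).τ * (freqNormSq k0 / freqNormSq (fun i => (W.phase j).m i * (n : ℤ)) +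
            (1 + ε) * σ * (g₁ ^ 2 * (1 - 4 * W.ramp / 3))) +
          40 * β * 2 * Λ * (W.phase j).τ * g₁ ^ 4 * (1 + g₁ ^ 2 * σ ^ 2) / Δ ^ 3 +
          48 * β * 2 * g₁ ^ 2 / (W.ramp * (W.phase j).τ * Λ * Δ ^ 3))) *
        ‖inner ℂ ζ ((pvSetup_cell W hn hκ.le ℓ hw₀ hdiv hmean hsupp).galerkinCoeffAt N
            ((p : ℝ) * W.period + W.start j) k0)‖ ^ 2 -
        β * ∑ J ∈ Wset.erase 0, ‖inner ℂ ζ ((pvSetup_cell W hn hκ.le ℓ hw₀ hdiv hmean hsupp).galerkinCoeffAt N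
            ((p : ℝ) * W.period + W.start j) (k0 + J • (fun i => (W.phase j).m i * (n : ℤ))))‖ ^ 2 ≤
      ‖inner ℂ ζ ((pvSetup_cell W hn hκ.le ℓ hw₀ hdiv hmean hsupp).galerkinCoeffAt N t k0)‖ ^ 2 := by
  classical
  set hPV := pvSetup_cell W hn hκ.le ℓ hw₀ hdiv hmean hsupp with hPVdef
  set K : Fin 3 → ℤ := fun i => (W.phase j).m i * (n : ℤ) with hK
  set A : ℂ := Complex.exp ((W.phase j).φ * Complex.I) *
      (1 / (2 * ((2 * Real.pi * ‖latticeVec (W.phase j).m‖ : ℝ) : ℂ) * Complex.I)) with hA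
  have hA0 : A ≠ 0 := layerAmp_ne_zero (W.phase j)
  set a : ℝ := (p : ℝ) * W.period + W.start j with ha
  set τ : ℝ := (W.phase j).τ with hτdef
  have hτ : 0 < τ := (W.phase j).τ_pos
  have hP : 0 < W.period := period_pos W
  have ha0 : 0 ≤ a := by
    have := start_nonneg W j; rw [ha]; positivity
  have haτP : a + τ ≤ (p + 1 : ℝ) * W.period := by
    have := start_add_tau_le_period W j; rw [ha, hτdef]; linarith
  -- the gauged components, the coupling function, the diagonal
  set v : ℝ → ℤ → ℂ := fun t J => (Complex.I * A / (‖A‖ : ℂ)) ^ (-J) * inner ℂ ζ (hPV.galerkinCoeffAt N t (k0 + J • K))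
    with hv
  set g : ℝ → ℝ := fun t => 2 * Real.pi * (∑ i, (W.phase j).e i * (k0 i : ℝ)) * ‖A‖ *
      ((1 / (n : ℝ)) * LatticeWord.trapezoid (W.start j) (W.phase j).τ W.ramp (Int.fract (t / W.period) * W.period)) /
    (κ * (4 * Real.pi ^ 2 * freqNormSq K)) with hgdef
  set d : ℤ → ℝ := fun J => freqNormSq (k0 + J • K) / freqNormSq K with hddef
  have hK0 : K ≠ 0 := cellFreq_ne_zero (W.phase j) hn
  have hKpos : 0 < freqNormSq K := by
    obtain ⟨i, hi⟩ : ∃ i, K i ≠ 0 := by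
      by_contra h
      push Not at h
      exact hK0 (funext h)
    have hi' : (K i : ℝ) ≠ 0 := by exact_mod_cast hi
    unfold freqNormSq
    exact lt_of_lt_of_le (by positivity) (Finset.single_le_sum (fun l _ => sq_nonneg ((K l : ℝ))) (Finset.mem_univ i))
  have hΛpos : 0 < Λ := by rw [hΛ]; positivity
  -- vanishing off the segment
  have hvsupp : ∀ t ∈ Icc a (a + τ), ∀ J, J ∉ Wset → v t J = 0 := by
    intro t _ J hJ
    have hnot : k0 + J • K ∉ freqBall N := fun h => hJ ((hW J).2 h)
    simp only [hv]
    rw [Torus.PVSetup.galerkinCoeffAt, coeffExt_of_not_mem _ hnot, inner_zero_right, mul_zero]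
  -- the replayed phase on the slot: `fract(t/P)·P = t - pP` before the period's end
  have hphase : ∀ t ∈ Icc a (a + τ), t < (p + 1 : ℝ) * W.period →
      Int.fract (t / W.period) * W.period = t - p * W.period := by
    intro t ht htP
    have e : t = (p : ℤ) * W.period + (t - p * W.period) := by push_cast; ring
    rw [e, fract_period_mul hP (p : ℤ) (by rw [ha] at ht; linarith [ht.1, start_nonneg W j]) (by linarith)]
    push_cast; ring
  -- the coupling in the trapezoid form
  have hgdef' : ∀ t ∈ Icc a (a + τ), g t = g₁ * LatticeWord.trapezoid 0 τ W.ramp (t - a) := by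
    intro t ht
    by_cases htP : t < (p + 1 : ℝ) * W.period
    · simp only [hgdef]
      rw [hphase t ht htP, trapezoid_shift, hg₁, hΛ, ha, hτdef]
      have e : t - p * W.period - W.start j = t - (p * W.period + W.start j) := by ring
      rw [e]; ring
    · -- the dead right end: both sides vanish
      have hteq : t = (p + 1 : ℝ) * W.period := le_antisymm (ht.2.trans haτP) (not_lt.1 htP)
      have hfr : Int.fract (t / W.period) * W.period = 0 := by
        rw [hteq, mul_div_assoc, div_self hP.ne', mul_one, show ((p : ℝ) + 1) = ((p + 1 : ℕ) : ℝ) by push_cast; ring,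
          Int.fract_natCast, zero_mul]
      have htrap0 : LatticeWord.trapezoid (W.start j) (W.phase j).τ W.ramp (Int.fract (t / W.period) * W.period) = 0 := by
        rw [hfr, trapezoid_shift, zero_sub]
        exact trapezoid_eq_zero_of_nonpos (W.phase j).τ_pos W.ramp_pos (neg_nonpos.2 (start_nonneg W j))
      have hta : t - a = τ := by
        have : a + τ = (p + 1 : ℝ) * W.period := le_antisymm haτP (hteq ▸ ht.2)
        linarith
      simp only [hgdef]
      rw [htrap0, hta, trapezoid_eq_of_mem_ramp_down hτ W.ramp_pos W.ramp_le
        ⟨by nlinarith [W.ramp_le, W.ramp_pos], le_rfl⟩]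
      simp
  -- the ladder on the full slot (interior and the dead right end)
  have hderiv : ∀ t ∈ Icc a (a + τ), ∀ J ∈ Wset, HasDerivWithinAt (fun t' => v t' J)
      (-(Λ : ℂ) * ((d J : ℂ) * v t J) -
        (g t : ℂ) * (Λ : ℂ) * ((((fun _ : ℤ => (1 : ℝ)) (J - 1) : ℝ) : ℂ) * v t (J - 1) -
          (((fun _ : ℤ => (1 : ℝ)) J : ℝ) : ℂ) * v t (J + 1))) (Icc a (a + τ)) t := by
    intro t ht J hJ
    have htT : t ∈ Icc 0 T := ⟨ha0.trans ht.1, ht.2.trans (by rw [ha, hτdef]; exact hT)⟩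
    have hsub : Icc a (a + τ) ⊆ Icc 0 T := Icc_subset_Icc ha0 (by rw [ha, hτdef]; exact hT)
    by_cases htP : t < (p + 1 : ℝ) * W.period
    · have hrt : Int.fract (t / W.period) * W.period ∈ Icc (W.start j) (W.start j + (W.phase j).τ) := by
        rw [hphase t ht htP]; rw [ha, hτdef] at ht; constructor <;> linarith [ht.1, ht.2]
      have h := hasDerivWithinAt_gauged_outOfPlane W hn hκ ℓ hw₀ hdiv hmean hsupp hBN htT j hrt k0 hζ₀ hζK J
        ((hW J).1 hJ)
      refine (h.mono hsub).congr_deriv ?_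
      simp only [hv, hgdef, hddef, hK, hA, hΛ]
      push_cast
      ring
    · -- dead right end
      have hteq : t = (p + 1 : ℝ) * W.period := le_antisymm (ht.2.trans haτP) (not_lt.1 htP)
      have hfr : Int.fract (t / W.period) * W.period = 0 := by
        rw [hteq, mul_div_assoc, div_self hP.ne', mul_one, show ((p : ℝ) + 1) = ((p + 1 : ℕ) : ℝ) by push_cast; ring,
          Int.fract_natCast, zero_mul]
      have hg0 : g t = 0 := by
        simp only [hgdef]
        rw [hfr, trapezoid_shift, zero_sub,
          trapezoid_eq_zero_of_nonpos (W.phase j).τ_pos W.ramp_pos (neg_nonpos.2 (start_nonneg W j))]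
        simp
      have h := hasDerivWithinAt_inner_galerkinCoeffAt_dead W hn hκ.le ℓ hw₀ hdiv hmean hsupp hBN htT hfr (k0 + J • K)
        ((hW J).1 hJ) ζ
      have h2 := (h.const_mul ((Complex.I * A / (‖A‖ : ℂ)) ^ (-J))).mono hsub
      refine h2.congr_deriv ?_
      rw [hg0]
      simp only [hv, hddef, hΛ]
      have hKc : ((freqNormSq K : ℝ) : ℂ) ≠ 0 := by exact_mod_cast hKpos.ne'
      push_cast
      field_simp
      ring
  -- the trapezoid theorem
  have hs : ∀ J ∈ Wset, |(fun _ : ℤ => (1 : ℝ)) J| ≤ 1 := fun J _ => by simp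
  have hγ : Real.sqrt 2 ^ 2 = (fun _ : ℤ => (1 : ℝ)) 0 ^ 2 + (fun _ : ℤ => (1 : ℝ)) (-1) ^ 2 := by
    rw [Real.sq_sqrt (by norm_num)]; norm_num
  have hσ' : σ = (fun _ : ℤ => (1 : ℝ)) (-1) ^ 2 / (d (-1) - d 0) + (fun _ : ℤ => (1 : ℝ)) 0 ^ 2 / (d 1 - d 0) := by
    rw [hσ]; simp only [hddef, one_pow, zero_smul, add_zero]
  have hgapd : ∀ J ∈ Wset, J ≠ 0 → d 0 + Δ ≤ d J := by
    intro J hJ hJ0; simpa [hddef] using hgap J hJ hJ0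
  have hβγ' : Real.sqrt 2 ^ 2 ≤ β * Δ * ε * σ := by rw [Real.sq_sqrt (by norm_num)]; exact hβγ
  have hsmall' : g₁ ^ 2 * (4 * Real.sqrt 2 ^ 2 / Δ + 2 * (1 + ε) * σ) +
      2 * (4 * β * Real.sqrt 2 ^ 2 * (Λ * |g₁| ^ 3 * σ + |g₁| / (W.ramp * τ) + Λ * |g₁| ^ 2) ^ 2 / (Λ * Δ ^ 3)) / Λ
        ≤ Δ := by
    rw [Real.sq_sqrt (by norm_num)]; exact hsmall
  have hd0' : 0 ≤ d 0 := by
    simp only [hddef]; exact div_nonneg (freqNormSq_nonneg _) (freqNormSq_nonneg _)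
  have hmain := slavedLadder_trapezoid_ge Wset h0 h1 hm1 d (fun _ => (1 : ℝ)) Λ Δ (Real.sqrt 2) σ ε β g₁ τ W.ramp a g v
    hs hγ (Real.sqrt_nonneg _) hσ' hΔ0 hgapd hd0' hΛpos hε hβ hβγ' hτ W.ramp_pos W.ramp_le hgdef' hsmall' hvsupp hderiv
  -- remove the gauge
  have hE0 : ∀ t, ‖v t 0‖ ^ 2 = ‖inner ℂ ζ (hPV.galerkinCoeffAt N t k0)‖ ^ 2 := by
    intro t; simp only [hv]; rw [norm_gauge_zpow_mul hA0]; simp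
  have hE : ∀ t, ∑ J ∈ Wset.erase 0, ‖v t J‖ ^ 2 =
      ∑ J ∈ Wset.erase 0, ‖inner ℂ ζ (hPV.galerkinCoeffAt N t (k0 + J • K))‖ ^ 2 := by
    intro t
    refine Finset.sum_congr rfl fun J _ => ?_
    simp only [hv]
    rw [norm_gauge_zpow_mul hA0]
  simp only [hE0, hE, Real.sq_sqrt (by norm_num : (0:ℝ) ≤ 2)] at hmain
  have hd0 : d 0 = freqNormSq k0 / freqNormSq K := by simp [hddef]
  rw [hd0] at hmain
  refine ⟨?_, fun t ht => ?_⟩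
  · convert hmain.1 using 3
  · convert hmain.2 t ht using 3


end Summit.AnomalousDissipation.AnomalousDissipation.Theorems.SolenoidalFractalHomogenisation.RealisedQuasiStaticCellLaw

end
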